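import Literature.NumberTheory.EllipticCurves.EichlerShimuraPeriodsGamma1
import Literature.NumberTheory.EllipticCurves.CuspFormEpsConj
import HarnessLib

/-!
# Eichler–Shimura periods on `S_k(Γ₁(N))` and the real structure `f ↦ f^ε`:
# the conjugation symmetry of the period cocycle

For `f ∈ S_{n+2}(Γ₁(N))` the Eichler–Shimura period cocycle of
`Literature.NumberTheory.EllipticCurves.EichlerShimuraPeriodsGamma1` is
`c_f(γ)(u, v) = ∫_τ^{i∞} (f|γ)(z)(zv - u)ⁿ dz - ∫_{γτ}^{i∞} f(z)(zv' - u')ⁿ dz`, `(u', v') = γ(u, v)`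
(`periodFn1 n f γ (u, v)`), and the period lattice `periodLatticeK1 n ⊆ S_{n+2}(Γ₁(N))^∨` is
generated by the functionals `λ_{σ,q} : f ↦ c_f(σ)(q)`, `σ ∈ Γ₀(N)`, `q ∈ ℤ²`.  Shimura's real
structure `f ↦ f^ε = \overline{f(-z̄)} = f ∣ J`, `J = diag(-1, 1)` (`epsConj`,
`Literature.NumberTheory.EllipticCurves.CuspFormEpsConj`; Shimura 1971, proof of Thm. 3.48) acts
on these periods through the involution `γ ↦ γ^ε = JγJ = (a, -b; -c, d)` of `SL(2, ℤ)` (`jConj`,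
Shimura's `X ↦ X^ε` of (3.5.19)) and `(u, v) ↦ (-u, v)` on `ℤ²`.  This file proves the
**conjugation symmetry of the period cocycle**

`c_{f^ε}(γ)(u, v) = (-1)^{n+1} \overline{c_f(γ^ε)(-ū, v̄)}`   (`periodFn1_epsConj`),

the change of variables `z ↦ -z̄` in the period integrals (Shimura 1971, §8.2, where the same
substitution underlies the real structure of `H¹_P(Γ, ℝ)` in Thm. 8.4; for the period polynomials
of level one this is the classical action of `ε = diag(-1, 1)` on periods, Kohnen–Zagier 1984,
§1.1), and draws the consequences for the **real-part kernel**

`K = {f ∈ S_{n+2}(Γ₁(N)) | re φ(f) = 0 for all φ ∈ Λ}`   (`IsRePeriodVanishing`)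

of the period lattice `Λ = periodLatticeK1 n`: `K` is a real subspace stable under `ε`, under all
Hecke operators `T_p` and all diamond operators `⟨d⟩` (the transposes preserve `Λ`), it meets
`iK` only in `0` (the lattice separates points), it splits as `K = K⁺ ⊕ K⁻` along `f^ε = ±f`, and
on the complex spans of `K^±` the periods satisfy the **reflection identities**

`c_g(σ)(u, v) = ± (-1)ⁿ c_g(σ^ε)(-u, v)`   (`periodFunctionalK1_eq_of_mem_span_plus/minus`).

These identities are the input of the proof (in sequel files) that `K = 0` in weights `≥ 6`,
i.e. that `Λ` spans `S_{n+2}(Γ₁(N))^∨` over `ℝ` — the injectivity of the *real* Eichler–Shimura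
map `f ↦ (re φ(f))_φ` (Shimura 1971, Thm. 8.4), one half of the statement that `Λ` is a full
lattice (Shimura (3.5.20), the hypothesis structure `HeckeStableRealLattice` of
`DeligneSerreProp27RealLatticeProofs`).

## Main results (all proved; no named facts)

* `flatConj ψ = (τ ↦ \overline{ψ(-τ̄)}) = ψ ∣[k] J` (`slash_J_eq_flatConj`), and its effect on the
  Eichler integrals of `EichlerShimuraPeriods`: `eichlerPrimitive_flatConj`,
  `powPrimitive_flatConj` (`∫_τ^{i∞} ψ^♭ zʲ dz = (-1)^{j+1} \overline{∫_{-τ̄}^{i∞} ψ zʲ dz}`),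
  `eichlerKernel_flatConj`.
* `periodFn1_epsConj`, `periodFunctionalK1_epsConj` — the conjugation symmetry.
* `IsRePeriodVanishing` and its properties: `.epsConj`, `.heckeT`, `.diamondOp`, `.add`, `.smul`,
  `eq_zero_of_isRePeriodVanishing_of_I_smul` (`K ∩ iK = 0`), the `±` parts `.plusPart`,
  `.minusPart` with `plusPart_add_minusPart`;
* `periodFunctionalK1_eq_of_epsConj_eq_self`, `periodFunctionalK1_eq_of_epsConj_eq_neg` and their
  extensions to complex spans `periodFunctionalK1_eq_of_mem_span_plus`,
  `periodFunctionalK1_eq_of_mem_span_minus` — the reflection identities.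

## References

* G. Shimura, *Introduction to the arithmetic theory of automorphic functions*, Publ. Math. Soc.
  Japan 11 (1971), proof of Thm. 3.48 (the involution `ε`, (3.5.19)), §8.2 (8.2.12)–(8.2.20) and
  Thm. 8.4 (the real Eichler–Shimura isomorphism).
* W. Kohnen, D. Zagier, *Modular forms with rational periods*, in: Modular forms (Durham 1983),
  Ellis Horwood 1984, 197–249, §1.1 (the action of `ε` on period polynomials, even and odd periods).
-/

noncomputable section

open scoped MatrixGroups ModularForm ComplexConjugate Topology Manifold

open CongruenceSubgroup Complex MeasureTheory Set Filter Function Matrix.SpecialLinearGroup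
open UpperHalfPlane hiding I

namespace Literature.NumberTheory.EllipticCurves.ModularForms

/-! ### The reflection `ψ ↦ ψ^♭`, `ψ^♭(τ) = \overline{ψ(-τ̄)}`, on functions on `ℍ` -/

section FlatConj

/-- The anti-holomorphic reflection of a function on `ℍ`: `ψ^♭(τ) = \overline{ψ(J • τ)}`,
`J • τ = -τ̄` (for a cusp form this is Shimura's `f^ε`, `epsConj`). [cite: Shimura1971, proof of Thm. 3.48] -/
def flatConj (ψ : ℍ → ℂ) : ℍ → ℂ := fun τ ↦ conj (ψ (J • τ))

/-- Unfolding `flatConj`. [folklore] -/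
@[simp] theorem flatConj_apply (ψ : ℍ → ℂ) (τ : ℍ) : flatConj ψ τ = conj (ψ (J • τ)) := rfl

/-- `ψ ∣[k] J = ψ^♭` for every weight `k` (Mathlib's slash action lets `J`, of determinant `-1`,
act through complex conjugation). [folklore] -/
theorem slash_J_eq_flatConj (ψ : ℍ → ℂ) (k : ℤ) : ψ ∣[k] J = flatConj ψ := by
  funext τ
  rw [ModularForm.slash_apply, flatConj_apply]
  simp

/-- `ψ^♭♭ = ψ` (`J² = 1`). [folklore] -/
@[simp] theorem flatConj_flatConj (ψ : ℍ → ℂ) : flatConj (flatConj ψ) = ψ := by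
  funext τ
  simp [smul_smul, J_mul_J]

/-- `(c ψ)^♭ = c̄ ψ^♭`. [folklore] -/
theorem flatConj_const_smul (c : ℂ) (ψ : ℍ → ℂ) : flatConj (c • ψ) = conj c • flatConj ψ := by
  funext τ
  simp

/-- `J • i = i`. [folklore] -/
theorem J_smul_I : J • UpperHalfPlane.I = UpperHalfPlane.I := by
  apply UpperHalfPlane.ext
  rw [coe_J_smul, UpperHalfPlane.coe_I, conj_I, neg_neg]

/-- Along a vertical ray: `J • (τ + it) = (J • τ) + it` for `t > 0`. [folklore] -/
theorem J_smul_ofComplex_add_mul_I (τ : ℍ) {t : ℝ} (ht : 0 < t) :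
    J • ofComplex ((τ : ℂ) + t * Complex.I) = ofComplex (((J • τ : ℍ) : ℂ) + t * Complex.I) := by
  have h1 : 0 < ((τ : ℂ) + t * Complex.I).im := by simpa using add_pos τ.im_pos ht
  have h2 : 0 < ((((J • τ : ℍ) : ℂ)) + t * Complex.I).im := by
    simpa using add_pos (J • τ).im_pos ht
  apply UpperHalfPlane.ext
  rw [coe_J_smul, coe_ofComplex h1, coe_ofComplex h2, coe_J_smul]
  simp only [map_add, map_mul, conj_ofReal, conj_I]
  ring

/-- **`∫_τ^{i∞} ψ^♭(z) dz = -\overline{∫_{-τ̄}^{i∞} ψ(z) dz}`** (substitute `z ↦ -z̄` in the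
vertical-ray integral). [folklore] -/
theorem eichlerPrimitive_flatConj (ψ : ℍ → ℂ) (τ : ℍ) :
    eichlerPrimitive (flatConj ψ) τ = -conj (eichlerPrimitive ψ (J • τ)) := by
  simp only [eichlerPrimitive]
  have hcongr : ∫ t in Ioi (0 : ℝ), flatConj ψ (ofComplex ((τ : ℂ) + t * Complex.I)) =
      ∫ t in Ioi (0 : ℝ), conj (ψ (ofComplex (((J • τ : ℍ) : ℂ) + t * Complex.I))) := by
    refine setIntegral_congr_fun measurableSet_Ioi fun t ht ↦ ?_
    rw [flatConj_apply, J_smul_ofComplex_add_mul_I τ ht]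
  rw [hcongr, integral_conj, map_mul, conj_I]
  ring

/-- `(eichlerPrimitive ψ)^♭`-form of `eichlerPrimitive_flatConj`:
`∫^{i∞} ψ^♭ = -(∫^{i∞} ψ)^♭` as functions. [folklore] -/
theorem eichlerPrimitive_flatConj_eq (ψ : ℍ → ℂ) :
    eichlerPrimitive (flatConj ψ) = (-1 : ℂ) • flatConj (eichlerPrimitive ψ) := by
  funext τ
  rw [eichlerPrimitive_flatConj, Pi.smul_apply, flatConj_apply, smul_eq_mul, neg_one_mul]

/-- `\overline{J • τ} = -τ` as complex numbers. [folklore] -/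
theorem conj_coe_J_smul (τ : ℍ) : conj (((J • τ : ℍ)) : ℂ) = -(τ : ℂ) := by
  rw [coe_J_smul, map_neg, conj_conj]

/-- **`∫_τ^{i∞} ψ^♭(z) zʲ dz = (-1)^{j+1} \overline{∫_{-τ̄}^{i∞} ψ(z) zʲ dz}`** for the iterated
integrals `powPrimitive` (induction on the integration-by-parts recursion). [folklore] -/
theorem powPrimitive_flatConj (j : ℕ) :
    ∀ (ψ : ℍ → ℂ) (τ : ℍ), powPrimitive j (flatConj ψ) τ =
      (-1) ^ (j + 1) * conj (powPrimitive j ψ (J • τ)) := by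
  induction j with
  | zero =>
    intro ψ τ
    rw [powPrimitive_zero, powPrimitive_zero, eichlerPrimitive_flatConj]
    ring
  | succ j ih =>
    intro ψ τ
    rw [powPrimitive_succ, powPrimitive_succ, eichlerPrimitive_flatConj_eq, powPrimitive_const_smul,
      ih (eichlerPrimitive ψ) τ, Pi.smul_apply, flatConj_apply, smul_eq_mul, map_add, map_mul,
      map_mul, map_pow, conj_coe_J_smul, map_add, map_natCast, map_one]
    have h1 : (-1 : ℂ) ^ (j * 2) = 1 := by
      rw [pow_mul', neg_one_sq, one_pow]
    linear_combination ((τ : ℂ) * (τ : ℂ) ^ j * conj (eichlerPrimitive ψ (J • τ))) * h1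

/-- The reflected coefficient vector `(u, v) ↦ (-ū, v̄)`. [folklore] -/
def flatVec (q : Fin 2 → ℂ) : Fin 2 → ℂ := ![-conj (q 0), conj (q 1)]

/-- First entry of `flatVec`. [folklore] -/
@[simp] theorem flatVec_zero (q : Fin 2 → ℂ) : flatVec q 0 = -conj (q 0) := rfl

/-- Second entry of `flatVec`. [folklore] -/
@[simp] theorem flatVec_one (q : Fin 2 → ℂ) : flatVec q 1 = conj (q 1) := rfl

/-- `flatVec` is an involution. [folklore] -/
@[simp] theorem flatVec_flatVec (q : Fin 2 → ℂ) : flatVec (flatVec q) = q := by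
  ext i
  fin_cases i <;> simp

/-- **`∫_τ^{i∞} ψ^♭(z)(zv - u)ⁿ dz = (-1)^{n+1} \overline{∫_{-τ̄}^{i∞} ψ(z)(z v̄ + ū)ⁿ dz}`**: the
reflection on the Eichler–Shimura kernel. [folklore] -/
theorem eichlerKernel_flatConj (n : ℕ) (ψ : ℍ → ℂ) (τ : ℍ) (q : Fin 2 → ℂ) :
    eichlerKernel n (flatConj ψ) τ q =
      (-1) ^ (n + 1) * conj (eichlerKernel n ψ (J • τ) (flatVec q)) := by
  simp only [eichlerKernel, map_sum, Finset.mul_sum]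
  refine Finset.sum_congr rfl fun j hj ↦ ?_
  have hjn : j ≤ n := Nat.lt_succ_iff.mp (Finset.mem_range.mp hj)
  obtain ⟨m, rfl⟩ : ∃ m, n = j + m := ⟨n - j, by omega⟩
  rw [Nat.add_sub_cancel_left, powPrimitive_flatConj]
  simp only [map_mul, map_pow, map_natCast, conj_conj, flatVec_zero, flatVec_one, neg_neg]
  rw [neg_pow (q 0)]
  ring

end FlatConj

/-! ### The conjugation symmetry of the period cocycle -/

section PeriodSymmetry

variable {N : ℕ} [NeZero N] {n : ℕ}

/-- `J γ = γ^ε J` in `GL(2, ℝ)`, `γ^ε = jConj γ = JγJ`. [folklore] -/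
theorem J_mul_mapGL (γ : SL(2, ℤ)) :
    (J : GL (Fin 2) ℝ) * mapGL ℝ γ = mapGL ℝ (jConj γ) * J := by
  rw [mapGL_jConj, mul_assoc, J_mul_J, mul_one]

omit [NeZero N] in
/-- `(f^ε) ∣ γ = (f ∣ γ^ε)^♭` as functions on `ℍ` (Shimura 1971, proof of Thm. 3.48:
`f^ε | [X]_k = (f | [X^ε]_k)^ε`). [cite: Shimura1971, proof of Thm. 3.48] -/
theorem coe_epsConj_slash (f : CuspForm (Gamma1 N) (n + 2)) (γ : SL(2, ℤ)) :
    ⇑(epsConj f) ∣[(n + 2 : ℤ)] γ = flatConj (⇑f ∣[(n + 2 : ℤ)] (jConj γ)) := by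
  rw [coe_epsConj, ModularForm.SL_slash, ModularForm.SL_slash, ← SlashAction.slash_mul,
    ← slash_J_eq_flatConj _ (n + 2 : ℤ), ← SlashAction.slash_mul]
  congr 1
  exact J_mul_mapGL γ

/-- `J • (γ • τ) = γ^ε • (J • τ)`. [folklore] -/
theorem J_smul_sl_smul (γ : SL(2, ℤ)) (τ : ℍ) : J • (γ • τ) = jConj γ • (J • τ) := by
  rw [MulAction.compHom_smul_def, MulAction.compHom_smul_def, smul_smul, smul_smul]
  congr 1
  exact J_mul_mapGL γ

/-- `flatVec (γ q) = γ^ε (flatVec q)`: `diag(-1,1) γ = γ^ε diag(-1,1)` on coefficient vectors.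
[folklore] -/
theorem flatVec_icmat_mulVec (γ : SL(2, ℤ)) (q : Fin 2 → ℂ) :
    flatVec ((icmat γ).mulVec q) = (icmat (jConj γ)).mulVec (flatVec q) := by
  ext i
  fin_cases i
  · simp [flatVec, icmat, Matrix.mulVec, dotProduct, Fin.sum_univ_two, jConj]
    ring
  · simp [flatVec, icmat, Matrix.mulVec, dotProduct, Fin.sum_univ_two, jConj]

omit [NeZero N] in
variable (n) in
/-- **Conjugation symmetry of the Eichler–Shimura period cocycle**: for `f ∈ S_{n+2}(Γ₁(N))`,
`γ ∈ SL(2, ℤ)` and `q = (u, v) ∈ ℂ²`,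
`c_{f^ε}(γ)(u, v) = (-1)^{n+1} \overline{c_f(γ^ε)(-ū, v̄)}`, where `f^ε = \overline{f(-z̄)}`
(`epsConj`) and `γ^ε = JγJ` (`jConj`): substitute `z ↦ -z̄` in both vertical-ray integrals
defining `periodFn1` (base point `i = J • i`). [cite: Shimura1971, §8.2 and proof of Thm. 3.48] -/
theorem periodFn1_epsConj (f : CuspForm (Gamma1 N) (n + 2)) (γ : SL(2, ℤ)) (q : Fin 2 → ℂ) :
    periodFn1 n (epsConj f) γ q = (-1) ^ (n + 1) * conj (periodFn1 n f (jConj γ) (flatVec q)) := by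
  have hcoe : (⇑(epsConj f) : ℍ → ℂ) = flatConj ⇑f := by
    rw [coe_epsConj, slash_J_eq_flatConj]
  rw [periodFn1, periodFn1, coe_epsConj_slash, eichlerKernel_flatConj, hcoe, eichlerKernel_flatConj,
    J_smul_I, J_smul_sl_smul, J_smul_I, flatVec_icmat_mulVec, map_sub]
  ring

/-- The reflected integer vector `(u, v) ↦ (-u, v)`. [folklore] -/
def negFstVec (q : Fin 2 → ℤ) : Fin 2 → ℤ := ![-q 0, q 1]

/-- First entry of `negFstVec`. [folklore] -/
@[simp] theorem negFstVec_zero (q : Fin 2 → ℤ) : negFstVec q 0 = -q 0 := rfl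

/-- Second entry of `negFstVec`. [folklore] -/
@[simp] theorem negFstVec_one (q : Fin 2 → ℤ) : negFstVec q 1 = q 1 := rfl

/-- `negFstVec` is an involution. [folklore] -/
@[simp] theorem negFstVec_negFstVec (q : Fin 2 → ℤ) : negFstVec (negFstVec q) = q := by
  ext i
  fin_cases i <;> simp

/-- On integer vectors `flatVec` is `negFstVec`. [folklore] -/
theorem flatVec_intCast (q : Fin 2 → ℤ) :
    flatVec (fun i ↦ (q i : ℂ)) = fun i ↦ ((negFstVec q i : ℤ) : ℂ) := by
  ext i
  fin_cases i <;> simp [flatVec]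

/-- `γ^ε` for `γ ∈ Γ₀(N)`, as an element of `Γ₀(N)`. [folklore] -/
def jConj0 (σ : Gamma0 N) : Gamma0 N := ⟨jConj σ, jConj_mem_Gamma0 σ.2⟩

omit [NeZero N] in
/-- Coercion of `jConj0`. [folklore] -/
@[simp] theorem coe_jConj0 (σ : Gamma0 N) : ((jConj0 σ : Gamma0 N) : SL(2, ℤ)) = jConj σ := rfl

omit [NeZero N] in
/-- `jConj` is an involution. [folklore] -/
@[simp] theorem jConj_jConj (γ : SL(2, ℤ)) : jConj (jConj γ) = γ := by
  ext i j
  fin_cases i <;> fin_cases j <;> simp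

omit [NeZero N] in
/-- `jConj0` is an involution. [folklore] -/
@[simp] theorem jConj0_jConj0 (σ : Gamma0 N) : jConj0 (jConj0 σ) = σ :=
  Subtype.ext (jConj_jConj _)

variable (n) in
/-- **Conjugation symmetry of the period functionals**: for `σ ∈ Γ₀(N)`, `q ∈ ℤ²`,
`λ_{σ,q}(f^ε) = (-1)^{n+1} \overline{λ_{σ^ε,(-u,v)}(f)}`. [cite: Shimura1971, §8.2 and proof of Thm. 3.48] -/
theorem periodFunctionalK1_epsConj (σ : Gamma0 N) (q : Fin 2 → ℤ) (f : CuspForm (Gamma1 N) (n + 2)) :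
    periodFunctionalK1 n σ q (epsConj f) =
      (-1) ^ (n + 1) * conj (periodFunctionalK1 n (jConj0 σ) (negFstVec q) f) := by
  rw [periodFunctionalK1_apply, periodFunctionalK1_apply, periodFn1_epsConj, flatVec_intCast]
  rfl

end PeriodSymmetry

/-! ### The real-part kernel `K = {f | re φ(f) = 0 for all φ ∈ Λ}` -/

section ReKernel

variable {N : ℕ} [NeZero N] {n : ℕ}

variable (n) in
/-- **The real-part kernel of the period lattice**: `f ∈ S_{n+2}(Γ₁(N))` all of whose
Eichler–Shimura periods `φ(f)`, `φ ∈ Λ = periodLatticeK1 n`, are purely imaginary.  The period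
lattice spans `S_{n+2}(Γ₁(N))^∨` over `ℝ` exactly when this kernel is `0` (the injectivity of the
real Eichler–Shimura map `f ↦ re ∫ f(z)(zv - u)ⁿ dz`, Shimura 1971, Thm. 8.4). [cite: Shimura1971, Thm. 8.4] -/
def IsRePeriodVanishing (f : CuspForm (Gamma1 N) (n + 2)) : Prop :=
  ∀ φ ∈ periodLatticeK1 (N := N) n, (φ f).re = 0

/-- It suffices to test the generators `λ_{σ,q}`. [folklore] -/
theorem isRePeriodVanishing_iff (f : CuspForm (Gamma1 N) (n + 2)) :
    IsRePeriodVanishing n f ↔ ∀ (σ : Gamma0 N) (q : Fin 2 → ℤ), (periodFunctionalK1 n σ q f).re = 0 := by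
  refine ⟨fun h σ q ↦ h _ (periodFunctionalK1_mem σ q), fun h φ hφ ↦ ?_⟩
  induction hφ using AddSubgroup.closure_induction with
  | mem x hx =>
    obtain ⟨⟨σ, q⟩, rfl⟩ := hx
    exact h σ q
  | zero => simp
  | add x y _ _ hx hy => rw [LinearMap.add_apply, add_re, hx, hy, add_zero]
  | neg x _ hx => rw [LinearMap.neg_apply, neg_re, hx, neg_zero]

namespace IsRePeriodVanishing

/-- `0 ∈ K`. [folklore] -/
theorem zero : IsRePeriodVanishing n (0 : CuspForm (Gamma1 N) (n + 2)) := fun φ _ ↦ by simp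

/-- `K` is closed under addition. [folklore] -/
theorem add {f g : CuspForm (Gamma1 N) (n + 2)} (hf : IsRePeriodVanishing n f)
    (hg : IsRePeriodVanishing n g) : IsRePeriodVanishing n (f + g) := fun φ hφ ↦ by
  rw [map_add, add_re, hf φ hφ, hg φ hφ, add_zero]

/-- `K` is closed under negation. [folklore] -/
theorem neg {f : CuspForm (Gamma1 N) (n + 2)} (hf : IsRePeriodVanishing n f) :
    IsRePeriodVanishing n (-f) := fun φ hφ ↦ by
  rw [map_neg, neg_re, hf φ hφ, neg_zero]

/-- `K` is closed under subtraction. [folklore] -/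
theorem sub {f g : CuspForm (Gamma1 N) (n + 2)} (hf : IsRePeriodVanishing n f)
    (hg : IsRePeriodVanishing n g) : IsRePeriodVanishing n (f - g) := by
  rw [sub_eq_add_neg]; exact hf.add hg.neg

/-- `K` is a real subspace: closed under real scalars. [folklore] -/
theorem smul {f : CuspForm (Gamma1 N) (n + 2)} (hf : IsRePeriodVanishing n f) (r : ℝ) :
    IsRePeriodVanishing n ((r : ℂ) • f) := fun φ hφ ↦ by
  rw [map_smul, smul_eq_mul, re_ofReal_mul, hf φ hφ, mul_zero]

/-- **`K` is stable under `ε`**: the periods of `f^ε` are `± \overline{periods of f}`. [folklore] -/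
theorem epsConj {f : CuspForm (Gamma1 N) (n + 2)} (hf : IsRePeriodVanishing n f) :
    IsRePeriodVanishing n (epsConj f) := by
  rw [isRePeriodVanishing_iff] at hf ⊢
  intro σ q
  rw [periodFunctionalK1_epsConj, show ((-1 : ℂ) ^ (n + 1)) = (((-1 : ℝ) ^ (n + 1) : ℝ) : ℂ) by
    push_cast; ring, re_ofReal_mul, conj_re, hf, mul_zero]

/-- **`K` is stable under the Hecke operators `T_p`** (all primes `p`, `U_p` for `p ∣ N` included):
`T_p^∨` preserves the period lattice. [folklore] -/
theorem heckeT {f : CuspForm (Gamma1 N) (n + 2)} (hf : IsRePeriodVanishing n f) (p : ℕ)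
    (hp : p.Prime) :
    IsRePeriodVanishing n (haveI : NeZero p := ⟨hp.ne_zero⟩; heckeT (Gamma1 N) (n + 2) p f) := by
  intro φ hφ
  haveI : NeZero p := ⟨hp.ne_zero⟩
  have h := (periodLatticeK1_fg_stable_separating N n).2.1 p hp φ hφ
  have := hf _ h
  rwa [LinearMap.dualMap_apply] at this

/-- **`K` is stable under the diamond operators `⟨d⟩`**: `⟨d⟩^∨` preserves the period lattice.
[folklore] -/
theorem diamondOp {f : CuspForm (Gamma1 N) (n + 2)} (hf : IsRePeriodVanishing n f) (d : ZMod N) :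
    IsRePeriodVanishing n (diamondOp N (n + 2) d f) := by
  intro φ hφ
  have h := (periodLatticeK1_fg_stable_separating N n).2.2.1 d φ hφ
  have := hf _ h
  rwa [LinearMap.dualMap_apply] at this

end IsRePeriodVanishing

/-- **`K ∩ iK = 0`**: if both `f` and `i f` have purely imaginary periods then all periods of `f`
vanish, so `f = 0` (the period lattice separates `S_{n+2}(Γ₁(N))`,
`eq_zero_of_forall_mem_periodLatticeK1`). [folklore] -/
theorem eq_zero_of_isRePeriodVanishing_of_I_smul {f : CuspForm (Gamma1 N) (n + 2)}
    (hf : IsRePeriodVanishing n f) (hif : IsRePeriodVanishing n (Complex.I • f)) : f = 0 := by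
  refine eq_zero_of_forall_mem_periodLatticeK1 f fun φ hφ ↦ ?_
  apply Complex.ext
  · rw [hf φ hφ, zero_re]
  · have := hif φ hφ
    rw [map_smul, smul_eq_mul, I_mul_re] at this
    rw [zero_im]
    linarith

/-! ### The `±` parts under `ε` -/

namespace IsRePeriodVanishing

/-- The `ε`-even part `f⁺ = (f + f^ε)/2`. [folklore] -/
def plusPart (f : CuspForm (Gamma1 N) (n + 2)) : CuspForm (Gamma1 N) (n + 2) :=
  ((2⁻¹ : ℝ) : ℂ) • (f + ModularForms.epsConj f)

/-- The `ε`-odd part `f⁻ = (f - f^ε)/2`. [folklore] -/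
def minusPart (f : CuspForm (Gamma1 N) (n + 2)) : CuspForm (Gamma1 N) (n + 2) :=
  ((2⁻¹ : ℝ) : ℂ) • (f - ModularForms.epsConj f)

omit [NeZero N] in
/-- `f = f⁺ + f⁻`. [folklore] -/
theorem plusPart_add_minusPart (f : CuspForm (Gamma1 N) (n + 2)) :
    plusPart f + minusPart f = f := by
  rw [plusPart, minusPart, ← smul_add, add_add_sub_cancel, ← two_smul ℂ f, smul_smul]
  norm_num

omit [NeZero N] in
/-- `(f⁺)^ε = f⁺`. [folklore] -/
theorem epsConj_plusPart (f : CuspForm (Gamma1 N) (n + 2)) :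
    ModularForms.epsConj (plusPart f) = plusPart f := by
  rw [plusPart, epsConj_smul, conj_ofReal, epsConj_add, epsConj_epsConj,
    add_comm (ModularForms.epsConj f) f]

omit [NeZero N] in
/-- `(f⁻)^ε = -f⁻`. [folklore] -/
theorem epsConj_minusPart (f : CuspForm (Gamma1 N) (n + 2)) :
    ModularForms.epsConj (minusPart f) = -minusPart f := by
  rw [minusPart, epsConj_smul, conj_ofReal, epsConj_sub, epsConj_epsConj, ← smul_neg, neg_sub]

/-- `f⁺ ∈ K` for `f ∈ K`. [folklore] -/
theorem plusPart_mem {f : CuspForm (Gamma1 N) (n + 2)} (hf : IsRePeriodVanishing n f) :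
    IsRePeriodVanishing n (plusPart f) :=
  (hf.add hf.epsConj).smul _

/-- `f⁻ ∈ K` for `f ∈ K`. [folklore] -/
theorem minusPart_mem {f : CuspForm (Gamma1 N) (n + 2)} (hf : IsRePeriodVanishing n f) :
    IsRePeriodVanishing n (minusPart f) :=
  (hf.sub hf.epsConj).smul _

end IsRePeriodVanishing

/-! ### The reflection identities on `K⁺`, `K⁻` and their complex spans -/

/-- A purely imaginary number `z` satisfies `z̄ = -z`. [folklore] -/
theorem conj_eq_neg_of_re_eq_zero {z : ℂ} (hz : z.re = 0) : conj z = -z := by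
  apply Complex.ext <;> simp [hz]

/-- **Reflection identity on `K⁺`**: if all periods of `f` are purely imaginary and `f^ε = f`
(real Fourier coefficients), then `λ_{σ,q}(f) = (-1)ⁿ λ_{σ^ε,(-u,v)}(f)` for all `σ ∈ Γ₀(N)`,
`q = (u, v) ∈ ℤ²`. [folklore] -/
theorem periodFunctionalK1_eq_of_epsConj_eq_self {f : CuspForm (Gamma1 N) (n + 2)}
    (hf : IsRePeriodVanishing n f) (hε : epsConj f = f) (σ : Gamma0 N) (q : Fin 2 → ℤ) :
    periodFunctionalK1 n σ q f = (-1) ^ n * periodFunctionalK1 n (jConj0 σ) (negFstVec q) f := by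
  have h := periodFunctionalK1_epsConj n σ q f
  rw [hε, conj_eq_neg_of_re_eq_zero ((isRePeriodVanishing_iff f).mp hf _ _)] at h
  rw [h]
  ring

/-- **Reflection identity on `K⁻`**: if all periods of `f` are purely imaginary and `f^ε = -f`
(purely imaginary Fourier coefficients), then `λ_{σ,q}(f) = (-1)^{n+1} λ_{σ^ε,(-u,v)}(f)`.
[folklore] -/
theorem periodFunctionalK1_eq_of_epsConj_eq_neg {f : CuspForm (Gamma1 N) (n + 2)}
    (hf : IsRePeriodVanishing n f) (hε : epsConj f = -f) (σ : Gamma0 N) (q : Fin 2 → ℤ) :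
    periodFunctionalK1 n σ q f =
      (-1) ^ (n + 1) * periodFunctionalK1 n (jConj0 σ) (negFstVec q) f := by
  have h := periodFunctionalK1_epsConj n σ q f
  rw [hε, map_neg, conj_eq_neg_of_re_eq_zero ((isRePeriodVanishing_iff f).mp hf _ _)] at h
  linear_combination -h

variable (N n) in
/-- The `ε`-even part of the real-part kernel, `K⁺ = {f ∈ K | f^ε = f}`, as a set. [folklore] -/
def rePeriodKerPlus : Set (CuspForm (Gamma1 N) (n + 2)) :=
  {f | IsRePeriodVanishing n f ∧ epsConj f = f}

variable (N n) in
/-- The `ε`-odd part of the real-part kernel, `K⁻ = {f ∈ K | f^ε = -f}`, as a set. [folklore] -/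
def rePeriodKerMinus : Set (CuspForm (Gamma1 N) (n + 2)) :=
  {f | IsRePeriodVanishing n f ∧ epsConj f = -f}

/-- Membership in `K⁺`. [folklore] -/
theorem mem_rePeriodKerPlus {f : CuspForm (Gamma1 N) (n + 2)} :
    f ∈ rePeriodKerPlus N n ↔ IsRePeriodVanishing n f ∧ epsConj f = f := Iff.rfl

/-- Membership in `K⁻`. [folklore] -/
theorem mem_rePeriodKerMinus {f : CuspForm (Gamma1 N) (n + 2)} :
    f ∈ rePeriodKerMinus N n ↔ IsRePeriodVanishing n f ∧ epsConj f = -f := Iff.rfl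

/-- **Reflection identity on the complex span of `K⁺`** (both sides are `ℂ`-linear in `g`):
`λ_{σ,q}(g) = (-1)ⁿ λ_{σ^ε,(-u,v)}(g)` for `g ∈ ℂ K⁺`. [folklore] -/
theorem periodFunctionalK1_eq_of_mem_span_plus {g : CuspForm (Gamma1 N) (n + 2)}
    (hg : g ∈ Submodule.span ℂ (rePeriodKerPlus N n)) (σ : Gamma0 N) (q : Fin 2 → ℤ) :
    periodFunctionalK1 n σ q g = (-1) ^ n * periodFunctionalK1 n (jConj0 σ) (negFstVec q) g := by
  induction hg using Submodule.span_induction with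
  | mem x hx => exact periodFunctionalK1_eq_of_epsConj_eq_self hx.1 hx.2 σ q
  | zero => simp only [map_zero, mul_zero]
  | add x y _ _ hx hy => rw [map_add, map_add, hx, hy, mul_add]
  | smul c x _ hx => rw [map_smul, map_smul, hx, smul_eq_mul, smul_eq_mul, mul_left_comm]

/-- **Reflection identity on the complex span of `K⁻`**:
`λ_{σ,q}(g) = (-1)^{n+1} λ_{σ^ε,(-u,v)}(g)` for `g ∈ ℂ K⁻`. [folklore] -/
theorem periodFunctionalK1_eq_of_mem_span_minus {g : CuspForm (Gamma1 N) (n + 2)}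
    (hg : g ∈ Submodule.span ℂ (rePeriodKerMinus N n)) (σ : Gamma0 N) (q : Fin 2 → ℤ) :
    periodFunctionalK1 n σ q g =
      (-1) ^ (n + 1) * periodFunctionalK1 n (jConj0 σ) (negFstVec q) g := by
  induction hg using Submodule.span_induction with
  | mem x hx => exact periodFunctionalK1_eq_of_epsConj_eq_neg hx.1 hx.2 σ q
  | zero => simp only [map_zero, mul_zero]
  | add x y _ _ hx hy => rw [map_add, map_add, hx, hy, mul_add]
  | smul c x _ hx => rw [map_smul, map_smul, hx, smul_eq_mul, smul_eq_mul, mul_left_comm]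

/-- **The complex spans of `K^±` are Hecke-stable**: `T_p (ℂ K⁺) ⊆ ℂ K⁺` (`T_p` commutes with `ε`
and preserves `K`). [folklore] -/
theorem heckeT_mem_span_plus {g : CuspForm (Gamma1 N) (n + 2)}
    (hg : g ∈ Submodule.span ℂ (rePeriodKerPlus N n)) (p : ℕ) (hp : p.Prime) [NeZero p] :
    heckeT (Gamma1 N) (n + 2) p g ∈ Submodule.span ℂ (rePeriodKerPlus N n) := by
  induction hg using Submodule.span_induction with
  | mem x hx =>
    refine Submodule.subset_span ⟨?_, ?_⟩
    · have := hx.1.heckeT p hp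
      exact this
    · rw [epsConj_heckeT p hp, hx.2]
  | zero => simp
  | add x y _ _ hx hy => rw [map_add]; exact add_mem hx hy
  | smul c x _ hx => rw [map_smul]; exact Submodule.smul_mem _ c hx

/-- `T_p (ℂ K⁻) ⊆ ℂ K⁻`. [folklore] -/
theorem heckeT_mem_span_minus {g : CuspForm (Gamma1 N) (n + 2)}
    (hg : g ∈ Submodule.span ℂ (rePeriodKerMinus N n)) (p : ℕ) (hp : p.Prime) [NeZero p] :
    heckeT (Gamma1 N) (n + 2) p g ∈ Submodule.span ℂ (rePeriodKerMinus N n) := by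
  induction hg using Submodule.span_induction with
  | mem x hx =>
    refine Submodule.subset_span ⟨?_, ?_⟩
    · have := hx.1.heckeT p hp
      exact this
    · rw [epsConj_heckeT p hp, hx.2, map_neg]
  | zero => simp
  | add x y _ _ hx hy => rw [map_add]; exact add_mem hx hy
  | smul c x _ hx => rw [map_smul]; exact Submodule.smul_mem _ c hx

/-- `⟨d⟩ (ℂ K⁺) ⊆ ℂ K⁺`. [folklore] -/
theorem diamondOp_mem_span_plus {g : CuspForm (Gamma1 N) (n + 2)}
    (hg : g ∈ Submodule.span ℂ (rePeriodKerPlus N n)) (d : ZMod N) :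
    diamondOp N (n + 2) d g ∈ Submodule.span ℂ (rePeriodKerPlus N n) := by
  induction hg using Submodule.span_induction with
  | mem x hx =>
    refine Submodule.subset_span ⟨hx.1.diamondOp d, ?_⟩
    rw [epsConj_diamondOp, hx.2]
  | zero => simp
  | add x y _ _ hx hy => rw [map_add]; exact add_mem hx hy
  | smul c x _ hx => rw [map_smul]; exact Submodule.smul_mem _ c hx

/-- `⟨d⟩ (ℂ K⁻) ⊆ ℂ K⁻`. [folklore] -/
theorem diamondOp_mem_span_minus {g : CuspForm (Gamma1 N) (n + 2)}
    (hg : g ∈ Submodule.span ℂ (rePeriodKerMinus N n)) (d : ZMod N) :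
    diamondOp N (n + 2) d g ∈ Submodule.span ℂ (rePeriodKerMinus N n) := by
  induction hg using Submodule.span_induction with
  | mem x hx =>
    refine Submodule.subset_span ⟨hx.1.diamondOp d, ?_⟩
    rw [epsConj_diamondOp, hx.2, map_neg]
  | zero => simp
  | add x y _ _ hx hy => rw [map_add]; exact add_mem hx hy
  | smul c x _ hx => rw [map_smul]; exact Submodule.smul_mem _ c hx

/-- **Reduction of `K = 0` to its `±` parts**: if the complex spans of `K⁺` and `K⁻` are both `0`,
then every `f` with purely imaginary periods vanishes (`f = f⁺ + f⁻` with `f^± ∈ K^±`). [folklore] -/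
theorem eq_zero_of_isRePeriodVanishing_of_span_eq_bot
    (hplus : Submodule.span ℂ (rePeriodKerPlus N n) = ⊥)
    (hminus : Submodule.span ℂ (rePeriodKerMinus N n) = ⊥)
    {f : CuspForm (Gamma1 N) (n + 2)} (hf : IsRePeriodVanishing n f) : f = 0 := by
  have h1 : IsRePeriodVanishing.plusPart f = 0 := by
    have : IsRePeriodVanishing.plusPart f ∈ Submodule.span ℂ (rePeriodKerPlus N n) :=
      Submodule.subset_span ⟨hf.plusPart_mem, IsRePeriodVanishing.epsConj_plusPart f⟩
    rw [hplus] at this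
    exact (Submodule.mem_bot ℂ).mp this
  have h2 : IsRePeriodVanishing.minusPart f = 0 := by
    have : IsRePeriodVanishing.minusPart f ∈ Submodule.span ℂ (rePeriodKerMinus N n) :=
      Submodule.subset_span ⟨hf.minusPart_mem, IsRePeriodVanishing.epsConj_minusPart f⟩
    rw [hminus] at this
    exact (Submodule.mem_bot ℂ).mp this
  rw [← IsRePeriodVanishing.plusPart_add_minusPart f, h1, h2, add_zero]

end ReKernel

end Literature.NumberTheory.EllipticCurves.ModularForms
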